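import Literature.NumberTheory.Automorphic.TwistedQuotientIndFunShapiro
import Literature.Algebra.Homology.GroupCohomologyShapiroNatural
import Mathlib.Data.Finset.Order
import HarnessLib

/-!
# The orbit decomposition of `H^q(Γ, indFun σ)` is natural in `σ`; cohomology of a directed union
# of lattices

Topic `NumberTheory/Automorphic`; namespace `Literature.NumberTheory.Automorphic.TwistedQuotient`.
Definitions with bodies and theorems; no named fact, no instance, no `sorry`.

Continuation of `TwistedQuotientIndFunShapiro`. For an `L`-equivariant map `φ : N → N'`
(`σ.IntertwiningMap σ'`):

* `indFunMap φ : indFun σ ⟶ indFun σ'` (postcomposition) and `indStabMap φ g₀` on the stabiliser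
  representations; `indOrbitRestrict` is natural (`indFunMap_comp_indOrbitRestrict`);
* `indToOrbitCohomologyNat P g₀ q` / `indOfOrbitCohomologyNat` — the maps
  `H^q(Γ, indFun σ) ⇄ H^q(Γ_{g₀L}, N)` built with the NATURAL Shapiro isomorphism
  `ResolutionComparison.shapiroIso` (any projective resolution `P` of `A` over `Γ`), the identities
  `of ≫ to = 𝟙`, orthogonality, `∑ to ≫ of = 𝟙`, the bijection
  `indToOrbitCohomologyNat_pi_bijective : H^q(Γ, indFun σ) ≅ ⊕_{x ∈ s} H^q(Γ_x, N_x)`, and its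
  NATURALITY `indToOrbitCohomologyNat_map_indFunMap`;
* **`exists_map_indFunMap_eq_of_directed`** — if `N = ⋃ N_i` is a directed union of
  `L`-subrepresentations, there are finitely many `Γ`-orbits on `𝒢 ⧸ L`, and the stabilisers
  `Γ_x` are of type `FP_∞` over `A`, then every class of `H^q(Γ, indFun σ_N)` comes from
  `H^q(Γ, indFun σ_{N_i})` for some `i` — the step "`ξ ∈ H^q(X_U, Ṽ) = H^q(X_U, M̃)[1/p]`, so
  `p^t ξ` comes from `H^q(X_U, M̃_{E'})` for a finite `E'/E` and `t ≫ 0`" of the proof of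
  [Scholze2015, Thm. V.4.1] (there implicit), via Brown VIII (4.6) per orbit
  (`ResolutionComparison.exists_map_eq_of_directed`).

## References

* P. Scholze, *On torsion in the cohomology of locally symmetric varieties*, Ann. of Math. 182
  (2015), §V.4, proof of Thm. V.4.1. [Scholze2015]
* K. S. Brown, *Cohomology of Groups*, GTM 87, III (6.2), VIII (4.6). [Brown1982CohomologyGroups]
-/

noncomputable section

open CategoryTheory
open scoped Classical
open Literature.Algebra.Homology

universe u

namespace Literature.NumberTheory.Automorphic

namespace TwistedQuotient

variable {A : Type u} [CommRing A] {Γ 𝒢 : Type u} [Group Γ] [Group 𝒢] (ι : Γ →* 𝒢)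
  (L : Subgroup 𝒢) {N N' : Type u} [AddCommGroup N] [Module A N] [AddCommGroup N'] [Module A N']
  (σ : Representation A L N) (σ' : Representation A L N')

/-! ### Functoriality in `σ` -/

/-- An intertwining map applied to `σ(l) v`. [folklore] -/
theorem intertwiningMap_apply_apply (φ : σ.IntertwiningMap σ') (l : L) (v : N) :
    φ (σ l v) = σ' l (φ v) :=
  LinearMap.congr_fun (φ.isIntertwining' l) v

/-- **`indFun` is functorial in `σ`**: an `L`-equivariant `φ : N → N'` induces
`indFun σ ⟶ indFun σ'`, `F ↦ φ ∘ F`. [folklore] -/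
def indFunMap (φ : σ.IntertwiningMap σ') : indFun ι L σ ⟶ indFun ι L σ' :=
  Rep.ofHom
    ⟨{ toFun := fun F => ⟨fun g => φ (F.1 g), fun g l => by
          change φ (F.1 (g * l)) = σ' l⁻¹ (φ (F.1 g))
          rw [F.2 g l, intertwiningMap_apply_apply]⟩
       map_add' := fun F F' => Subtype.ext (funext fun g => map_add φ (F.1 g) (F'.1 g))
       map_smul' := fun a F => Subtype.ext (funext fun g => map_smul φ a (F.1 g)) },
      fun γ => LinearMap.ext fun F => Subtype.ext (funext fun g => rfl)⟩

/-- Unfolding lemma for `indFunMap`. [folklore] -/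
@[simp]
theorem indFunMap_hom_apply_val (φ : σ.IntertwiningMap σ') (F : indFun ι L σ) (g : 𝒢) :
    ((indFunMap ι L σ σ' φ).hom F).1 g = φ (F.1 g) :=
  rfl

/-- `indFunMap` is injective on functions if `φ` is injective. [folklore] -/
theorem indFunMap_injective (φ : σ.IntertwiningMap σ') (hφ : Function.Injective φ) :
    Function.Injective (indFunMap ι L σ σ' φ).hom := fun _ _ h =>
  Subtype.ext (funext fun g => hφ (congrArg (fun G : indFun ι L σ' => G.1 g) h))

variable (g₀ : 𝒢)

/-- The same map between the stabiliser representations `N_{g₀} → N'_{g₀}`. [folklore] -/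
def indStabMap (φ : σ.IntertwiningMap σ') :
    indStabilizerRep ι L σ g₀ ⟶ indStabilizerRep ι L σ' g₀ :=
  Rep.ofHom ⟨φ.toLinearMap, fun γ => φ.isIntertwining' (conjHom ι L g₀ γ)⟩

/-- Unfolding lemma for `indStabMap`. [folklore] -/
@[simp]
theorem indStabMap_hom_apply (φ : σ.IntertwiningMap σ') (v : N) :
    (indStabMap ι L σ σ' g₀ φ).hom v = φ v :=
  rfl

/-- `indStabMap` is injective if `φ` is. [folklore] -/
theorem indStabMap_injective (φ : σ.IntertwiningMap σ') (hφ : Function.Injective φ) :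
    Function.Injective (indStabMap ι L σ σ' g₀ φ).hom := fun _ _ h => hφ h

/-- `indStabMap` is compatible with composition (pointwise form). [folklore] -/
theorem indStabMap_comp_apply {N'' : Type u} [AddCommGroup N''] [Module A N'']
    (σ'' : Representation A L N'') (φ : σ.IntertwiningMap σ') (ψ : σ'.IntertwiningMap σ'') (v : N) :
    (indStabMap ι L σ σ' g₀ φ ≫ indStabMap ι L σ' σ'' g₀ ψ).hom v = ψ (φ v) :=
  rfl

/-- **Naturality of the restriction to an orbit**:
`indFunMap φ ≫ restrict' = restrict ≫ coindMap φ`. [folklore] -/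
theorem indFunMap_comp_indOrbitRestrict (φ : σ.IntertwiningMap σ') :
    indFunMap ι L σ σ' φ ≫ indOrbitRestrict ι L σ' g₀ =
      indOrbitRestrict ι L σ g₀ ≫
        Rep.coindMap (orbitStabilizer ι L (g₀ : 𝒢 ⧸ L)).subtype (indStabMap ι L σ σ' g₀ φ) := by
  refine Rep.hom_ext (Representation.IntertwiningMap.ext (LinearMap.ext fun F => ?_))
  exact Subtype.ext (funext fun γ => rfl)

/-! ### The orbit decomposition built with the natural Shapiro isomorphism -/

variable (P : ProjectiveResolution (Rep.trivial A Γ A))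

/-- `H^q(Γ, indFun σ) → H^q(Γ, Coind) ≅ H^q(Γ_{g₀L}, N)` with `ResolutionComparison.shapiroIso`.
[cite: Brown1982CohomologyGroups, III (6.2)] -/
def indToOrbitCohomologyNat (q : ℕ) :
    groupCohomology (indFun ι L σ) q ⟶ groupCohomology (indStabilizerRep ι L σ g₀) q :=
  groupCohomology.map (MonoidHom.id Γ) (indOrbitRestrict ι L σ g₀) q ≫
    (ResolutionComparison.shapiroIso (orbitStabilizer ι L (g₀ : 𝒢 ⧸ L)) P
      (indStabilizerRep ι L σ g₀) q).hom

/-- `H^q(Γ_{g₀L}, N) ≅ H^q(Γ, Coind) → H^q(Γ, indFun σ)` with `ResolutionComparison.shapiroIso`.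
[cite: Brown1982CohomologyGroups, III (6.2)] -/
def indOfOrbitCohomologyNat (q : ℕ) :
    groupCohomology (indStabilizerRep ι L σ g₀) q ⟶ groupCohomology (indFun ι L σ) q :=
  (ResolutionComparison.shapiroIso (orbitStabilizer ι L (g₀ : 𝒢 ⧸ L)) P
      (indStabilizerRep ι L σ g₀) q).inv ≫
    groupCohomology.map (MonoidHom.id Γ) (indOrbitExtend ι L σ g₀) q

/-- `of ≫ to = 𝟙`. [cite: Brown1982CohomologyGroups, III (6.2)] -/
@[reassoc]
theorem indOfOrbitCohomologyNat_comp_indToOrbitCohomologyNat (q : ℕ) :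
    indOfOrbitCohomologyNat ι L σ g₀ P q ≫ indToOrbitCohomologyNat ι L σ g₀ P q = 𝟙 _ := by
  simp only [indOfOrbitCohomologyNat, indToOrbitCohomologyNat, Category.assoc]
  rw [← groupCohomology.map_id_comp_assoc, indOrbitExtend_comp_indOrbitRestrict,
    groupCohomology.map_id, Category.id_comp, Iso.inv_hom_id]

/-- `to ≫ of = H^q(restrict ≫ extend)`. [folklore] -/
theorem indToOrbitCohomologyNat_comp_indOfOrbitCohomologyNat_eq_map (q : ℕ) :
    indToOrbitCohomologyNat ι L σ g₀ P q ≫ indOfOrbitCohomologyNat ι L σ g₀ P q =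
      groupCohomology.map (MonoidHom.id Γ)
        (indOrbitRestrict ι L σ g₀ ≫ indOrbitExtend ι L σ g₀) q := by
  simp only [indOfOrbitCohomologyNat, indToOrbitCohomologyNat, Category.assoc,
    Iso.hom_inv_id_assoc]
  rw [← groupCohomology.map_id_comp]

/-- `∑_x (to_x ≫ of_x) = 𝟙` for a complete system of orbit representatives.
[cite: Brown1982CohomologyGroups, III (6.2)] -/
theorem sum_indToOrbitCohomologyNat_comp_indOfOrbitCohomologyNat (s : Finset 𝒢)
    (hdisj : ∀ x ∈ s, ∀ y ∈ s, (∃ γ : Γ, ι γ • (x : 𝒢 ⧸ L) = (y : 𝒢 ⧸ L)) → x = y)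
    (hcov : ∀ g : 𝒢, ∃ x ∈ s, ∃ γ : Γ, ι γ • (x : 𝒢 ⧸ L) = (g : 𝒢 ⧸ L)) (q : ℕ) :
    ∑ x ∈ s, (indToOrbitCohomologyNat ι L σ x P q ≫ indOfOrbitCohomologyNat ι L σ x P q) =
      𝟙 _ := by
  simp_rw [indToOrbitCohomologyNat_comp_indOfOrbitCohomologyNat_eq_map]
  rw [← Literature.Algebra.Homology.map_id_sum,
    sum_indOrbitRestrict_comp_indOrbitExtend ι L σ s hdisj hcov, groupCohomology.map_id]

/-- Orthogonality: `of_x ≫ to_y = 0` for representatives of different orbits. [folklore] -/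
theorem indOfOrbitCohomologyNat_comp_indToOrbitCohomologyNat_of_not {g₁ : 𝒢}
    (h : ¬ ∃ γ : Γ, ι γ • (g₀ : 𝒢 ⧸ L) = (g₁ : 𝒢 ⧸ L)) (q : ℕ) :
    indOfOrbitCohomologyNat ι L σ g₀ P q ≫ indToOrbitCohomologyNat ι L σ g₁ P q = 0 := by
  simp only [indOfOrbitCohomologyNat, indToOrbitCohomologyNat, Category.assoc]
  rw [← groupCohomology.map_id_comp_assoc, indOrbitExtend_comp_indOrbitRestrict_of_not ι L σ g₀ h,
    Literature.Algebra.Homology.map_id_zero, Limits.zero_comp, Limits.comp_zero]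

/-- Evaluation of a finite sum of morphisms of `ModuleCat`. [folklore] -/
private theorem moduleCat_sum_apply'' {M M' : ModuleCat.{u} A} {I : Type*} (t : Finset I)
    (φ : I → (M ⟶ M')) (z : M) : (∑ i ∈ t, φ i) z = ∑ i ∈ t, φ i z := by
  change (∑ i ∈ t, φ i).hom z = ∑ i ∈ t, (φ i).hom z
  rw [ModuleCat.hom_sum, LinearMap.sum_apply]

/-- **`H^q(Γ, indFun σ) ≅ ⊕_{x ∈ s} H^q(Γ_x, N_x)`** (natural version): `z ↦ (to_x z)_{x ∈ s}` is a
bijection. [cite: Brown1982CohomologyGroups, III (6.2); Scholze2015, §V.4] -/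
theorem indToOrbitCohomologyNat_pi_bijective (s : Finset 𝒢)
    (hdisj : ∀ x ∈ s, ∀ y ∈ s, (∃ γ : Γ, ι γ • (x : 𝒢 ⧸ L) = (y : 𝒢 ⧸ L)) → x = y)
    (hcov : ∀ g : 𝒢, ∃ x ∈ s, ∃ γ : Γ, ι γ • (x : 𝒢 ⧸ L) = (g : 𝒢 ⧸ L)) (q : ℕ) :
    Function.Bijective fun (z : groupCohomology (indFun ι L σ) q) (x : s) =>
      (indToOrbitCohomologyNat ι L σ x.1 P q z : groupCohomology (indStabilizerRep ι L σ x.1) q) := by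
  classical
  have hsum : ∀ z : groupCohomology (indFun ι L σ) q,
      ∑ x ∈ s, indOfOrbitCohomologyNat ι L σ x P q (indToOrbitCohomologyNat ι L σ x P q z) = z :=
    fun z => by
    have h := congrArg
      (fun φ : groupCohomology (indFun ι L σ) q ⟶ groupCohomology (indFun ι L σ) q => φ z)
      (sum_indToOrbitCohomologyNat_comp_indOfOrbitCohomologyNat ι L σ P s hdisj hcov q)
    simp only at h
    rw [moduleCat_sum_apply''] at h
    exact h
  refine ⟨fun z₁ z₂ h => ?_, fun a => ?_⟩
  · rw [← hsum z₁, ← hsum z₂]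
    refine Finset.sum_congr rfl fun x hx => ?_
    have hx' := congr_fun h ⟨x, hx⟩
    simp only at hx'
    change indOfOrbitCohomologyNat ι L σ x P q (indToOrbitCohomologyNat ι L σ x P q z₁) =
      indOfOrbitCohomologyNat ι L σ x P q (indToOrbitCohomologyNat ι L σ x P q z₂)
    rw [hx']
  · refine ⟨∑ x : s, indOfOrbitCohomologyNat ι L σ x.1 P q (a x), funext fun y => ?_⟩
    simp only
    rw [map_sum, Finset.sum_eq_single_of_mem y (Finset.mem_univ y) fun x _ hxy => ?_]
    · change (indOfOrbitCohomologyNat ι L σ y.1 P q ≫ indToOrbitCohomologyNat ι L σ y.1 P q) (a y) =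
        a y
      rw [indOfOrbitCohomologyNat_comp_indToOrbitCohomologyNat]
      rfl
    · have hne : ¬ ∃ γ : Γ, ι γ • (x.1 : 𝒢 ⧸ L) = (y.1 : 𝒢 ⧸ L) := fun h =>
        hxy (Subtype.ext (hdisj x.1 x.2 y.1 y.2 h))
      change (indOfOrbitCohomologyNat ι L σ x.1 P q ≫ indToOrbitCohomologyNat ι L σ y.1 P q) (a x) =
        0
      rw [indOfOrbitCohomologyNat_comp_indToOrbitCohomologyNat_of_not ι L σ x.1 P hne q]
      rfl

/-- **Naturality of the components in `σ`**:
`to_x (H^q(indFunMap φ) z) = H^q(Γ_x, φ) (to_x z)`. [cite: Brown1982CohomologyGroups, III (6.2)] -/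
theorem indToOrbitCohomologyNat_map_indFunMap (φ : σ.IntertwiningMap σ') (q : ℕ)
    (z : groupCohomology (indFun ι L σ) q) :
    indToOrbitCohomologyNat ι L σ' g₀ P q
        (groupCohomology.map (MonoidHom.id Γ) (indFunMap ι L σ σ' φ) q z) =
      groupCohomology.map (MonoidHom.id (orbitStabilizer ι L (g₀ : 𝒢 ⧸ L)))
        (indStabMap ι L σ σ' g₀ φ) q (indToOrbitCohomologyNat ι L σ g₀ P q z) := by
  simp only [indToOrbitCohomologyNat, ModuleCat.hom_comp, LinearMap.comp_apply]
  rw [← ResolutionComparison.shapiroIso_hom_apply_map]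
  congr 1
  change (groupCohomology.map (MonoidHom.id Γ) (indFunMap ι L σ σ' φ) q ≫
      groupCohomology.map (MonoidHom.id Γ) (indOrbitRestrict ι L σ' g₀) q) z =
    (groupCohomology.map (MonoidHom.id Γ) (indOrbitRestrict ι L σ g₀) q ≫
      groupCohomology.map (MonoidHom.id Γ) (Rep.coindMap (orbitStabilizer ι L (g₀ : 𝒢 ⧸ L)).subtype
        (indStabMap ι L σ σ' g₀ φ)) q) z
  rw [← groupCohomology.map_id_comp, ← groupCohomology.map_id_comp, indFunMap_comp_indOrbitRestrict]

/-! ### Cohomology of a directed union of lattices -/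

section Union

variable {ι' : Type*} [Preorder ι'] [IsDirected ι' (· ≤ ·)] [Nonempty ι']
  {Nst : ι' → Type u} [∀ i, AddCommGroup (Nst i)] [∀ i, Module A (Nst i)]
  (σst : ∀ i, Representation A L (Nst i))
  (φ : ∀ i, (σst i).IntertwiningMap σ) (hinj : ∀ i, Function.Injective (φ i))
  (t : ∀ ⦃i j⦄, i ≤ j → (σst i).IntertwiningMap (σst j))
  (ht : ∀ ⦃i j⦄ (h : i ≤ j) (v : Nst i), φ j (t h v) = φ i v)
  (hcovN : ∀ v : N, ∃ i, ∃ w : Nst i, φ i w = v)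

include hinj ht hcovN in
/-- **Per orbit**: every class of `H^q(Γ_x, N)` comes from some `H^q(Γ_x, N_i)` when `Γ_x` is of
type `FP_∞` (Brown VIII (4.6), `ResolutionComparison.exists_map_eq_of_directed`).
[cite: Brown1982CohomologyGroups, VIII (4.6)] -/
theorem exists_map_indStabMap_eq_of_directed
    (Px : ProjectiveResolution (Rep.trivial A (orbitStabilizer ι L (g₀ : 𝒢 ⧸ L)) A))
    (hPx : ∀ i, ∃ m : ℕ, Nonempty (Px.complex.X i ≅
      Rep.free A (orbitStabilizer ι L (g₀ : 𝒢 ⧸ L)) (Fin m)))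
    (q : ℕ) (z : groupCohomology (indStabilizerRep ι L σ g₀) q) :
    ∃ i, ∃ y : groupCohomology (indStabilizerRep ι L (σst i) g₀) q,
      groupCohomology.map (MonoidHom.id _) (indStabMap ι L (σst i) σ g₀ (φ i)) q y = z :=
  ResolutionComparison.exists_map_eq_of_directed Px hPx
    (A := fun i => indStabilizerRep ι L (σst i) g₀) (B := indStabilizerRep ι L σ g₀)
    (fun i => indStabMap ι L (σst i) σ g₀ (φ i))
    (fun i => indStabMap_injective ι L (σst i) σ g₀ (φ i) (hinj i))
    (fun i j h => indStabMap ι L (σst i) (σst j) g₀ (t h))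
    (fun _ _ h => Rep.hom_ext (Representation.IntertwiningMap.ext (LinearMap.ext fun v => ht h v)))
    (fun v => hcovN v) q z

include hinj ht hcovN in
/-- **Cohomology of a directed union of lattices.** If `N = ⋃_i N_i` (directed, `L`-stable,
`φ_i : N_i ↪ N`), the `Γ`-orbits on `𝒢 ⧸ L` admit a finite complete system `s` of representatives,
and each stabiliser `Γ_x`, `x ∈ s`, has a projective resolution of `A` by finite free modules
(type `FP_∞`), then every class of `H^q(Γ, indFun σ_N)` is the image of a class of
`H^q(Γ, indFun σ_{N_i})` for some `i`. [cite: Scholze2015, §V.4 (proof of Thm. V.4.1)]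
[cite: Brown1982CohomologyGroups, VIII (4.6)] -/
theorem exists_map_indFunMap_eq_of_directed (s : Finset 𝒢)
    (hdisj : ∀ x ∈ s, ∀ y ∈ s, (∃ γ : Γ, ι γ • (x : 𝒢 ⧸ L) = (y : 𝒢 ⧸ L)) → x = y)
    (hcov : ∀ g : 𝒢, ∃ x ∈ s, ∃ γ : Γ, ι γ • (x : 𝒢 ⧸ L) = (g : 𝒢 ⧸ L))
    (hFP : ∀ x ∈ s, ∃ Px : ProjectiveResolution (Rep.trivial A (orbitStabilizer ι L (x : 𝒢 ⧸ L)) A),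
      ∀ i, ∃ m : ℕ, Nonempty (Px.complex.X i ≅ Rep.free A (orbitStabilizer ι L (x : 𝒢 ⧸ L)) (Fin m)))
    (q : ℕ) (z : groupCohomology (indFun ι L σ) q) :
    ∃ i, ∃ y : groupCohomology (indFun ι L (σst i)) q,
      groupCohomology.map (MonoidHom.id Γ) (indFunMap ι L (σst i) σ (φ i)) q y = z := by
  classical
  -- any projective resolution of `A` over `Γ` computes the (natural) orbit components
  let P : ProjectiveResolution (Rep.trivial A Γ A) := Rep.barResolution A Γ
  -- per orbit: index `i x` and preimage `y x` of the `x`-component of `z`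
  have hx : ∀ x ∈ s, ∃ i, ∃ y : groupCohomology (indStabilizerRep ι L (σst i) x) q,
      groupCohomology.map (MonoidHom.id _) (indStabMap ι L (σst i) σ x (φ i)) q y =
        indToOrbitCohomologyNat ι L σ x P q z := fun x hx => by
    obtain ⟨Px, hPx⟩ := hFP x hx
    exact exists_map_indStabMap_eq_of_directed ι L σ x σst φ hinj t ht hcovN Px hPx q _
  choose i y hy using hx
  -- a common index `M ≥ i x`
  have hiM' : ∃ M, ∀ (x : 𝒢) (hx : x ∈ s), i x hx ≤ M := by
    obtain ⟨M, hM⟩ := Finset.exists_le (s.attach.image fun x : {x // x ∈ s} => i x.1 x.2)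
    exact ⟨M, fun x hx => hM _ (Finset.mem_image.2 ⟨⟨x, hx⟩, Finset.mem_attach _ _, rfl⟩)⟩
  obtain ⟨M, hiM⟩ := hiM'
  -- transport the preimages to the stage `M`
  let w : ∀ x : s, groupCohomology (indStabilizerRep ι L (σst M) x.1) q := fun x =>
    groupCohomology.map (MonoidHom.id _)
      (indStabMap ι L (σst (i x.1 x.2)) (σst M) x.1 (t (hiM x.1 x.2))) q (y x.1 x.2)
  have hw : ∀ x : s, groupCohomology.map (MonoidHom.id _) (indStabMap ι L (σst M) σ x.1 (φ M)) q (w x) =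
      indToOrbitCohomologyNat ι L σ x.1 P q z := fun x => by
    change (groupCohomology.map (MonoidHom.id _)
        (indStabMap ι L (σst (i x.1 x.2)) (σst M) x.1 (t (hiM x.1 x.2))) q ≫
      groupCohomology.map (MonoidHom.id _) (indStabMap ι L (σst M) σ x.1 (φ M)) q) (y x.1 x.2) = _
    rw [← groupCohomology.map_id_comp]
    have hcomp : indStabMap ι L (σst (i x.1 x.2)) (σst M) x.1 (t (hiM x.1 x.2)) ≫
        indStabMap ι L (σst M) σ x.1 (φ M) = indStabMap ι L (σst (i x.1 x.2)) σ x.1 (φ (i x.1 x.2)) :=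
      Rep.hom_ext (Representation.IntertwiningMap.ext (LinearMap.ext fun v => ht (hiM x.1 x.2) v))
    rw [hcomp]
    exact hy x.1 x.2
  -- glue at the stage `M` and compare components in `σ`
  obtain ⟨Y, hY⟩ := (indToOrbitCohomologyNat_pi_bijective ι L (σst M) P s hdisj hcov q).2 w
  refine ⟨M, Y, (indToOrbitCohomologyNat_pi_bijective ι L σ P s hdisj hcov q).1 (funext fun x => ?_)⟩
  simp only
  rw [indToOrbitCohomologyNat_map_indFunMap, ← hw x]
  congr 1
  exact congr_fun hY x

end Union

end TwistedQuotient

end Literature.NumberTheory.Automorphic
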